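import Summits.BirchSwinnertonDyer.BirchSwinnertonDyer.Theorems.CountingDoorF2AtThreeSelmerAverageInterface
import HarnessLib

/-!
# BirchSwinnertonDyer / CountingDoorF2AtThree — support lemmas for crux I1
# `SelmerThreeAverageLargeF2` (stmt-BirchSwinnertonDyer-19440): the ORBIT-WEIGHT form of the count
# interface (Bhargava–Shankar's «weight each integral orbit by `1/m`»)

Route `route-BirchSwinnertonDyer-CountingDoorF2AtThree` (cell bsd-rank2). Companion of
`Theorems/CountingDoorF2AtThreeSelmerAverageInterface.lean`. In an orbit parametrisation the pairs
`(E, ξ)` (`ξ` a non-marked Selmer class) are not INJECTED into integral orbits but COVERED by them: a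
rational orbit with locally soluble, irreducible representatives splits into `m(E, ξ) ≥ 1` integral
orbits, and the geometry of numbers bounds the number of integral orbits WEIGHTED by `1/m`
(Bhargava–Shankar, Ann. Math. 181 (2015) §3.2: "it suffices to weight each integral orbit by
`1/m(f)`"; Bhargava–Ho 2022 §2 (5)–(7)). The bookkeeping identity behind this is the fibre count
`#α = ∑_{b ∈ β} 1/#π⁻¹(π b)` for a surjection `π : β ↠ α` of finite types
(`card_eq_sum_inv_card_fiber`), whence the **weighted count interface**
`averageOnLE_natCard_of_weightedCover`: if for every `ε > 0` and all large `X` the pairs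
`(a, σ)`, `a ∈ Φ(<X)`, `σ ∈ S a`, are covered by a finite type `β` (surjection `π`) with
`∑_b 1/#fibre(b) ≤ (c + ε)·#Φ(<X)`, then `Φ.AverageOnLE (fun a ↦ #(S a)) c`; and the I1 instance
`selmerThreeAverageLargeF2_of_weightedCover` (route decl BY NAME, `c = 27`, `S a` = the non-marked
`3`-Selmer classes of `E_a`). Pure bookkeeping; the open content of I1 (the parametrisation and the
weighted geometry-of-numbers count) is the hypothesis. PARTITION: none — r_an ≥ 2, summit axis S0;
TWIN (D-0056): n/a. B1 honesty: no analytic rank, no `L`-function; no S0 motion.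

References: M. Bhargava, A. Shankar, Ann. of Math. 181 (2015) §3.2 [BhargavaShankarAnnals2015];
M. Bhargava, W. Ho, arXiv:2207.03309 §2 [BhargavaHo2022].
-/

set_option linter.dupNamespace false

noncomputable section

open scoped Classical
open Filter Topology Finset
open WeierstrassCurve Literature.NumberTheory.EllipticCurves
  Literature.NumberTheory.EllipticCurves.BhargavaHo2022
  Summit.BirchSwinnertonDyer.Rank2
  Summit.BirchSwinnertonDyer.BirchSwinnertonDyer.Theses.CountingDoorF2AtThree

namespace Summit.BirchSwinnertonDyer.BirchSwinnertonDyer.Theorems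

universe w v

/-- **Fibre count**: for a surjection `π : β ↠ α` of finite types,
`#α = ∑_{b ∈ β} 1/#π⁻¹(π b)` (each fibre contributes `#fibre · (1/#fibre) = 1`). Fibres are written
as subtypes `{b' // π b' = π b}` (no decidability instance in the statement). [folklore] -/
theorem card_eq_sum_inv_card_fiber {α : Type w} {β : Type v} [Fintype α] [Fintype β]
    (π : β → α) (hπ : Function.Surjective π) :
    (Fintype.card α : ℝ) = ∑ b : β, ((Nat.card {b' : β // π b' = π b} : ℝ))⁻¹ := by
  have hfibre : ∀ a : α, (Nat.card {b' : β // π b' = a} : ℝ) =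
      ((Finset.univ.filter fun b' : β ↦ π b' = a).card : ℝ) := fun a ↦ by
    rw [Nat.card_eq_fintype_card, Fintype.card_subtype]
  simp_rw [hfibre]
  rw [← Finset.sum_fiberwise (s := Finset.univ) (g := π)
    (f := fun b : β ↦ (((Finset.univ.filter fun b' : β ↦ π b' = π b).card : ℝ))⁻¹)]
  have hfib : ∀ a : α, ∑ b ∈ Finset.univ.filter (fun b : β ↦ π b = a),
      (((Finset.univ.filter fun b' : β ↦ π b' = π b).card : ℝ))⁻¹ = 1 := by
    intro a
    have hconst : ∀ b ∈ Finset.univ.filter (fun b : β ↦ π b = a),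
        (((Finset.univ.filter fun b' : β ↦ π b' = π b).card : ℝ))⁻¹ =
          (((Finset.univ.filter fun b' : β ↦ π b' = a).card : ℝ))⁻¹ := by
      intro b hb
      rw [(Finset.mem_filter.1 hb).2]
    rw [Finset.sum_congr rfl hconst, Finset.sum_const, nsmul_eq_mul]
    have hpos : (0 : ℝ) < (Finset.univ.filter fun b' : β ↦ π b' = a).card := by
      obtain ⟨b, hb⟩ := hπ a
      exact_mod_cast Finset.card_pos.2 ⟨b, Finset.mem_filter.2 ⟨Finset.mem_univ _, hb⟩⟩
    exact mul_inv_cancel₀ hpos.ne'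
  simp only [hfib, Finset.sum_const, Finset.card_univ, nsmul_eq_mul, mul_one]

/-- `Nat.card` form of the fibre count bound: a finite WEIGHTED cover bounds the cardinality.
[folklore] -/
theorem natCard_le_of_weightedCover {α : Type w} {β : Type v} [Finite α] [Fintype β] (π : β → α)
    (hπ : Function.Surjective π) {B : ℝ}
    (hB : ∑ b : β, ((Nat.card {b' : β // π b' = π b} : ℝ))⁻¹ ≤ B) :
    (Nat.card α : ℝ) ≤ B := by
  haveI : Fintype α := Fintype.ofFinite α
  rw [Nat.card_eq_fintype_card, card_eq_sum_inv_card_fiber π hπ]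
  exact hB

variable (Φ : CongruenceFamily₂)

/-- **Weighted count interface** (Bhargava–Shankar's «weight each integral orbit by `1/m`»): if for
every `ε > 0` and all large `X` the pairs `(a, σ)`, `a ∈ Φ(<X)`, `σ ∈ S a`, are COVERED by a finite
type `β` through a surjection `π` with `∑_{b ∈ β} 1/#π⁻¹(π b) ≤ (c + ε)·#Φ(<X)`, then
`Φ.AverageOnLE (fun a ↦ #(S a)) c`. [cite: BhargavaShankarAnnals2015, §3.2 (weights 1/m(f))] -/
theorem averageOnLE_natCard_of_weightedCover {S : Params → Type w} {c : ℝ} (hc : 0 ≤ c)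
    (hS : ∀ a, Φ.Mem a → Finite (S a))
    (h : ∀ ε : ℝ, 0 < ε → ∀ᶠ X : ℕ in atTop, ∃ (β : Type v) (_ : Fintype β)
      (π : β → Σ a : Φ.below X, S a.1), Function.Surjective π ∧
        ∑ b : β, ((Nat.card {b' : β // π b' = π b} : ℝ))⁻¹ ≤ (c + ε) * (Φ.below X).card) :
    Φ.AverageOnLE (fun a ↦ (Nat.card (S a) : ℝ)) c := by
  refine averageOnLE_natCard_of_card_sigma_le Φ hc hS fun ε hε ↦ (h ε hε).mono ?_
  rintro X ⟨β, hβ, π, hπ, hsum⟩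
  haveI : ∀ a : Φ.below X, Finite (S a.1) := fun a ↦ hS a.1 ((Φ.mem_below_iff a.1 X).1 a.2).1
  exact natCard_le_of_weightedCover π hπ hsum

/-- **The weighted count interface for the route decl I1** (`SelmerThreeAverageLargeF2`, BY NAME):
it suffices, for every large `Φ ⊆ F₂`, every `ε > 0` and all large `X`, to COVER the non-marked
`3`-Selmer pairs `(a, ξ)` over `Φ(<X)` by finite types `β_X` (surjections `π_X`) of total weight
`∑_b 1/#fibre(b) ≤ (27 + ε)·#Φ(<X)` — the weighted count of irreducible, locally soluble integral
orbits of bounded height an orbit parametrisation of the `3`-Selmer elements of curves with two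
marked points would have to deliver (this is I1's open content).
[cite: BhargavaHo2022, §2 items (5)–(7) and Thm. 3.1(c); BhargavaShankarAnnals2015, §3.2] -/
theorem selmerThreeAverageLargeF2_of_weightedCover
    (H : ∀ Φ : CongruenceFamily₂, Φ.IsLarge → ∀ ε : ℝ, 0 < ε → ∀ᶠ X : ℕ in atTop,
      ∃ (β : Type) (_ : Fintype β)
      (π : β → Σ a : Φ.below X, {ξ : a.1.curve.galH1Torsion 3 | ξ ∈ a.1.curve.selmerGroup 3 ∧
        ∀ h' : a.1.IsMember, ξ ∉ AddSubgroup.closure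
          ({a.1.curve.kummerMapTorsion 3 (three_zsmul_geomPoints_surjective h')
              (Params.markedPoint₁ h'),
            a.1.curve.kummerMapTorsion 3 (three_zsmul_geomPoints_surjective h')
              (Params.markedPoint₂ h')} : Set (a.1.curve.galH1Torsion 3))}),
      Function.Surjective π ∧
        ∑ b : β, ((Nat.card {b' : β // π b' = π b} : ℝ))⁻¹ ≤ (27 + ε) * (Φ.below X).card) :
    SelmerThreeAverageLargeF2 := by
  intro Φ hΦ
  have hg := averageOnLE_natCard_of_weightedCover Φ (c := 27) (by norm_num)
    (S := fun a : Params ↦ {ξ : a.curve.galH1Torsion 3 | ξ ∈ a.curve.selmerGroup 3 ∧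
        ∀ h' : a.IsMember, ξ ∉ AddSubgroup.closure
          ({a.curve.kummerMapTorsion 3 (three_zsmul_geomPoints_surjective h')
              (Params.markedPoint₁ h'),
            a.curve.kummerMapTorsion 3 (three_zsmul_geomPoints_surjective h')
              (Params.markedPoint₂ h')} : Set (a.curve.galH1Torsion 3))})
    (fun a ha ↦ finite_nonMarkedSelmer ha.1) (H Φ hΦ)
  refine selmerThreeAverageLE_of_nonMarked Φ hg fun a _ h hdiv ↦ ?_
  rw [← nonMarkedSelmer_eq_diff h hdiv, ← Nat.card_coe_set_eq]

end Summit.BirchSwinnertonDyer.BirchSwinnertonDyer.Theorems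

end
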